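import Literature.Barriers.ValiantsHypothesis.BDGIL24GelfandTsetlinComponents
import HarnessLib

/-!
# The Gelfand–Tsetlin component `V_T` lies in the weight space of weight
# `(|λ^{(1)}|, |λ^{(2)}| − |λ^{(1)}|, …, |λ^{(k)}| − |λ^{(k-1)}|)` ([BDGIL24, §4.5]) — PROVED
# (`BergEtAl2024.gtWeight`, `BergEtAl2024.gtSubspace_le_weightSpace`)

Companion of `BDGIL24GelfandTsetlinComponents.lean` (val-lit row vdBDGIL24-A; M. van den Berg,
P. Dutta, F. Gesmundo, C. Ikenmeyer, V. Lysikov, *Algebraic metacomplexity and representation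
theory*, arXiv:2411.03444 [BergEtAl2024]). [BDGIL24, §4.5, p.23 (PDF p.24), p0024.txt:L55–L56]:

> "The 1-dimensional subspace `V_T` corresponding to the pattern `T = λ^{(1)} → λ^{(2)} → ⋯ → λ^{(k)}`
> is spanned by a weight vector of weight `(|λ^{(1)}|, |λ^{(2)}| − |λ^{(1)}|, …, |λ^{(k)}| − |λ^{(k-1)}|)`."

Typed and proved here is the WEIGHT part of this sentence, for the `T`-isotypic components
`gtSubspace ρ T` of any representation `ρ` of `GL_k` (any field): **`V_T ⊆ V_χ` with
`χ = gtWeight T = (|λ^{(j+1)}| − |λ^{(j)}|)_{j<k}`** (`|λ^{(0)}| = 0`), i.e. the Gelfand–Tsetlin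
decomposition refines the weight-space decomposition as well as the isotypic one
(`gtSubspace_le_hwSubrep_last`); in particular the `T`-isotypic projection of [BDGIL24, Thm. 1.1
(4)] (`thm_1_1_gt`) lands in a single weight space (`gtSubspace_coordRep_le_weightSpace`). The
"1-dimensional" part (multiplicity-free branching `GL_k ↓ GL_{k-1}`, the interlacing rule) is NOT
typed.

Proof (`glLift_diagonal_smul_of_mem_gtSubspace`, induction on the level `ℓ`): a diagonal
`t = diag(t₁, …, t_ℓ) ∈ GL_ℓ` factors as the central element `t_ℓ · 1_ℓ` times the lift of
`diag(t₁/t_ℓ, …, t_{ℓ-1}/t_ℓ) ∈ GL_{ℓ-1}` (`exists_factor_diagonal`); the scalar `s · 1_ℓ` acts on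
the `λ^{(ℓ)}`-isotypic component of `GL_ℓ` by `s^{|λ^{(ℓ)}|}` (`scalarGL_smul_of_mem_hwSubrep`: it
is central and acts on a highest-weight vector of weight `χ` by `∏ s^{χ_i}`), and the exponents
telescope (`∑_{j<ℓ} (|λ^{(j+1)}| − |λ^{(j)}|) = |λ^{(ℓ)}|`).

Definitions: `scalarGL n s` (the unit `s · 1 ∈ GL_n`, plumbing) and `gtWeight T` (the displayed
weight). No named facts. Honest framing: representation-theoretic bookkeeping; nothing here bears
on `VP ≠ VNP`.

## References
* [BergEtAl2024] arXiv:2411.03444, §4.5, p.23 (PDF p.24): Gelfand–Tsetlin patterns for `𝔤𝔩_k`,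
  the weight of `V_T` (p0024.txt:L55–L56), "`E_{k,k}` acts on the copy of `V_μ` in `V_λ` as
  multiplication by `|λ| − |μ|`" (p0024.txt:L16–L17).
-/

noncomputable section

open MvPolynomial


namespace Literature.Barriers.ValiantsHypothesis

namespace BergEtAl2024

open Literature.Computability.AlgebraicComplexity Literature.NumberTheory.DiophantineGeometry
open scoped BigOperators

section Scalars

variable {K V : Type*} [Field K] [AddCommGroup V] [Module K V] {n : ℕ}

/-- The invertible scalar matrix `s · 1 ∈ GL_n` (plumbing: the centre of `GL_n`, through which
"`E_{k,k}` acts … as multiplication by `|λ| − |μ|`" is rendered at the group level). [folklore] -/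
def scalarGL (n : ℕ) (s : Kˣ) : GL (Fin n) K :=
  ⟨(s : K) • (1 : Matrix (Fin n) (Fin n) K), (s : K)⁻¹ • (1 : Matrix (Fin n) (Fin n) K),
    by rw [Matrix.smul_mul, Matrix.mul_smul, Matrix.one_mul, smul_smul, mul_inv_cancel₀ s.ne_zero,
      one_smul],
    by rw [Matrix.smul_mul, Matrix.mul_smul, Matrix.one_mul, smul_smul, inv_mul_cancel₀ s.ne_zero,
      one_smul]⟩

/-- `∏ a^{f i} = a^{∑ f i}` for integer exponents and `a ≠ 0` (Mathlib has the `ℕ` version only).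
[folklore] -/
private theorem prod_zpow_eq_zpow_sum {ι : Type*} (s : Finset ι) (f : ι → ℤ) {a : K} (ha : a ≠ 0) :
    ∏ i ∈ s, a ^ f i = a ^ ∑ i ∈ s, f i := by
  classical
  induction s using Finset.induction_on with
  | empty => simp
  | insert i s hi ih => rw [Finset.prod_insert hi, Finset.sum_insert hi, ih, zpow_add₀ ha]

/-- The matrix of `scalarGL n s` is `s · 1`. [folklore] -/
private theorem coe_scalarGL (s : Kˣ) :
    ((scalarGL n s : GL (Fin n) K) : Matrix (Fin n) (Fin n) K) = (s : K) • 1 := rfl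

/-- Entries of `s · 1`. [folklore] -/
private theorem scalarGL_apply (s : Kˣ) (i j : Fin n) :
    ((scalarGL n s : GL (Fin n) K) : Matrix (Fin n) (Fin n) K) i j = if i = j then (s : K) else 0 := by
  rw [coe_scalarGL, Matrix.smul_apply, Matrix.one_apply, smul_eq_mul, mul_ite, mul_one, mul_zero]

/-- Scalar matrices are central. [folklore] -/
private theorem scalarGL_comm (s : Kˣ) (g : GL (Fin n) K) : scalarGL n s * g = g * scalarGL n s := by
  refine Units.ext ?_
  rw [Units.val_mul, Units.val_mul, coe_scalarGL, Matrix.smul_mul, Matrix.mul_smul, Matrix.one_mul,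
    Matrix.mul_one]

/-- Scalar matrices are diagonal. [folklore] -/
private theorem isDiagonalGL_scalarGL (s : Kˣ) : IsDiagonalGL (scalarGL n s) := by
  rw [isDiagonalGL_iff_isDiag]
  intro i j hij
  rw [scalarGL_apply, if_neg hij]

/-- The weight character of `s · 1` is `s^{|χ|}`. [folklore] -/
private theorem weightChar_scalarGL (χ : Weight (Fin n)) (s : Kˣ) :
    weightChar χ (scalarGL n s) = (s : K) ^ χ.size := by
  rw [weightChar, Weight.size, ← prod_zpow_eq_zpow_sum _ _ s.ne_zero]
  refine Finset.prod_congr rfl fun i _ => ?_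
  rw [scalarGL_apply, if_pos rfl]

/-- **Scalars act on the `χ`-isotypic component by `s^{|χ|}`**: the centre `K^× · 1 ⊂ GL_n` acts on
a highest-weight vector of weight `χ` by the character `s ↦ s^{∑ χ_i}`, hence (being central) on
all its translates and on their span `hwSubrep ρ χ`. [cite: BergEtAl2024, §4.5, p.23 (PDF p.24)] locator: paper:arxiv-2411.03444 p0024.txt:L16–L17 -/
theorem scalarGL_smul_of_mem_hwSubrep (ρ : Representation K (GL (Fin n) K) V) (χ : Weight (Fin n))
    (s : Kˣ) {v : V} (hv : v ∈ hwSubrep ρ χ) :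
    ρ (scalarGL n s) v = ((s : K) ^ χ.size) • v := by
  refine Submodule.span_induction (p := fun v _ => ρ (scalarGL n s) v = ((s : K) ^ χ.size) • v)
    ?_ ?_ ?_ ?_ hv
  · rintro _ ⟨g, w, hw, rfl⟩
    rw [← Module.End.mul_apply, ← map_mul, scalarGL_comm, map_mul, Module.End.mul_apply,
      hw _ (isDiagonalGL_scalarGL s).isUpperTriangular, map_smul, weightChar_scalarGL]
  · rw [map_zero, smul_zero]
  · intro x y _ _ hx hy
    rw [map_add, hx, hy, smul_add]
  · intro c x _ hx
    rw [map_smul, hx, smul_comm]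

end Scalars

section Weights

variable {K V : Type*} [Field K] [AddCommGroup V] [Module K V] {k : ℕ}

/-- **The weight of a Gelfand–Tsetlin chain**: `(|λ^{(1)}|, |λ^{(2)}| − |λ^{(1)}|, …,
|λ^{(k)}| − |λ^{(k-1)}|)` ("The 1-dimensional subspace `V_T` corresponding to the pattern
`T = λ^{(1)} → ⋯ → λ^{(k)}` is spanned by a weight vector of weight
`(|λ^{(1)}|, |λ^{(2)}| − |λ^{(1)}|, …, |λ^{(k)}| − |λ^{(k-1)}|)`"; `|λ^{(0)}| = 0`).
[cite: BergEtAl2024, §4.5, p.23 (PDF p.24)] locator: paper:arxiv-2411.03444 p0024.txt:L55–L56 -/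
def gtWeight (T : GTPattern k) : Weight (Fin k) :=
  fun i => (T i.succ).size - (T (Fin.castSucc i)).size

/-- The size of the empty weight is `0`. [folklore] -/
private theorem size_weight_fin_zero (χ : Weight (Fin 0)) : χ.size = 0 := by
  simp [Weight.size]

/-- Telescoping: `∑_{i<ℓ} (|T_{i+1}| − |T_i|) = |T_ℓ|` (`|T_0| = 0`). [folklore] -/
private theorem sum_gtWeight_eq (T : GTPattern k) (ℓ : ℕ) (hℓ : ℓ ≤ k) :
    ∑ i : Fin ℓ, gtWeight T (Fin.castLE hℓ i) = (T ⟨ℓ, Nat.lt_succ_of_le hℓ⟩).size := by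
  induction ℓ with
  | zero =>
    rw [Finset.univ_eq_empty, Finset.sum_empty]
    exact (size_weight_fin_zero _).symm
  | succ ℓ ih =>
    rw [Fin.sum_univ_castSucc, show (fun i : Fin ℓ => gtWeight T (Fin.castLE hℓ (Fin.castSucc i))) =
      fun i => gtWeight T (Fin.castLE (Nat.le_of_succ_le hℓ) i) from rfl, ih (Nat.le_of_succ_le hℓ)]
    rw [gtWeight]
    have h1 : (Fin.castLE hℓ (Fin.last ℓ)).succ = ⟨ℓ + 1, Nat.lt_succ_of_le hℓ⟩ := Fin.ext (by simp)
    have h2 : Fin.castSucc (Fin.castLE hℓ (Fin.last ℓ)) = ⟨ℓ, Nat.lt_succ_of_le (Nat.le_of_succ_le hℓ)⟩ :=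
      Fin.ext (by simp)
    rw [h1, h2]
    ring

/-- The diagonal torus element `diag(t₁, …, t_{ℓ+1})` of `GL_{ℓ+1}` factors as the scalar
`t_{ℓ+1} · 1` times the lift of `diag(t₁/t_{ℓ+1}, …, t_ℓ/t_{ℓ+1}) ∈ GL_ℓ`. [folklore] -/
private theorem exists_factor_diagonal {ℓ : ℕ} (t : GL (Fin (ℓ + 1)) K) (ht : IsDiagonalGL t) :
    ∃ (c : Kˣ) (t' : GL (Fin ℓ) K), IsDiagonalGL t' ∧
      (c : K) = (t : Matrix (Fin (ℓ + 1)) (Fin (ℓ + 1)) K) (Fin.last ℓ) (Fin.last ℓ) ∧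
      (∀ i : Fin ℓ, (t' : Matrix (Fin ℓ) (Fin ℓ) K) i i * c =
        (t : Matrix (Fin (ℓ + 1)) (Fin (ℓ + 1)) K) (Fin.castSucc i) (Fin.castSucc i)) ∧
      t = scalarGL (ℓ + 1) c * glLift (Nat.le_succ ℓ) t' := by
  have hdiag := (isDiagonalGL_iff_isDiag t).1 ht
  have hne : ∀ i, (t : Matrix (Fin (ℓ + 1)) (Fin (ℓ + 1)) K) i i ≠ 0 :=
    fun i => diag_ne_zero_of_isUpperTriangular ht.isUpperTriangular i
  set c : Kˣ := Units.mk0 _ (hne (Fin.last ℓ)) with hc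
  -- the rescaled truncation
  set D : Fin ℓ → K := fun i => (t : Matrix (Fin (ℓ + 1)) (Fin (ℓ + 1)) K) (Fin.castSucc i)
    (Fin.castSucc i) * (c : K)⁻¹ with hD
  have hD0 : ∀ i, D i ≠ 0 := fun i => mul_ne_zero (hne _) (inv_ne_zero (hne _))
  have hdet : (Matrix.diagonal D).det ≠ 0 := by
    rw [Matrix.det_diagonal]
    exact Finset.prod_ne_zero_iff.2 fun i _ => hD0 i
  set t' : GL (Fin ℓ) K := Matrix.GeneralLinearGroup.mkOfDetNeZero _ hdet with ht'
  have ht'coe : (t' : Matrix (Fin ℓ) (Fin ℓ) K) = Matrix.diagonal D := rfl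
  refine ⟨c, t', ?_, rfl, fun i => ?_, ?_⟩
  · rw [isDiagonalGL_iff_isDiag, ht'coe]
    exact Matrix.isDiag_diagonal D
  · rw [ht'coe, Matrix.diagonal_apply_eq, hD]
    simp only
    rw [inv_mul_cancel_right₀ c.ne_zero]
  · refine Units.ext ?_
    rw [Units.val_mul, coe_scalarGL, Matrix.smul_mul, Matrix.one_mul, coe_glLift, ht'coe]
    ext i j
    rw [Matrix.smul_apply, liftMat_apply_eq, smul_eq_mul]
    by_cases hij : i = j
    · subst hij
      by_cases hi : (i : ℕ) < ℓ
      · rw [dif_pos hi, dif_pos hi, Matrix.diagonal_apply_eq, hD]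
        simp only
        have : Fin.castSucc (⟨i, hi⟩ : Fin ℓ) = i := Fin.ext rfl
        rw [this, mul_comm, inv_mul_cancel_right₀ c.ne_zero]
      · rw [dif_neg hi, if_pos rfl, mul_one]
        have : i = Fin.last ℓ := by
          refine Fin.ext ?_
          have := i.2
          simp only [Fin.val_last]
          omega
        rw [this, hc, Units.val_mk0]
    · rw [hdiag hij]
      by_cases hi : (i : ℕ) < ℓ
      · by_cases hj : (j : ℕ) < ℓ
        · rw [dif_pos hi, dif_pos hj, Matrix.diagonal_apply_ne, mul_zero]
          intro h
          exact hij (Fin.ext (by simpa using congrArg Fin.val h))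
        · rw [dif_pos hi, dif_neg hj, mul_zero]
      · rw [dif_neg hi, if_neg hij, mul_zero]

/-- **The Gelfand–Tsetlin component `V_T` lies in the weight space of weight
`(|λ^{(1)}|, |λ^{(2)}| − |λ^{(1)}|, …, |λ^{(k)}| − |λ^{(k-1)}|)`**, level by level: for every
`ℓ ≤ k` and every diagonal `t ∈ GL_ℓ`, `diag(t, 1)` acts on `V_T` by `∏_{i<ℓ} t_i^{|λ^{(i+1)}|-|λ^{(i)}|}`
(induction on `ℓ`: `diag(t₁,…,t_ℓ) = t_ℓ · diag(t₁/t_ℓ, …, t_{ℓ-1}/t_ℓ, 1)` and the scalar `t_ℓ · 1_ℓ`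
acts on the `λ^{(ℓ)}`-isotypic component of `GL_ℓ` by `t_ℓ^{|λ^{(ℓ)}|}`).
[cite: BergEtAl2024, §4.5, p.23 (PDF p.24)] locator: paper:arxiv-2411.03444 p0024.txt:L55–L56 -/
theorem glLift_diagonal_smul_of_mem_gtSubspace (ρ : Representation K (GL (Fin k) K) V)
    (T : GTPattern k) {v : V} (hv : v ∈ gtSubspace ρ T) :
    ∀ (ℓ : ℕ) (hℓ : ℓ ≤ k) (t : GL (Fin ℓ) K), IsDiagonalGL t →
      ρ (glLift hℓ t) v = (∏ i : Fin ℓ, (t : Matrix (Fin ℓ) (Fin ℓ) K) i i ^ gtWeight T (Fin.castLE hℓ i)) • v := by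
  intro ℓ
  induction ℓ with
  | zero =>
    intro hℓ t _
    have h1 : glLift hℓ t = 1 := by
      refine Units.ext ?_
      rw [coe_glLift, Units.val_one]
      ext i j
      rw [liftMat_apply_eq, dif_neg (Nat.not_lt_zero _), Matrix.one_apply]
    rw [h1, map_one, Module.End.one_apply, Finset.univ_eq_empty, Finset.prod_empty, one_smul]
  | succ ℓ ih =>
    intro hℓ t ht
    obtain ⟨c, t', ht', hc, ht'c, htfac⟩ := exists_factor_diagonal t ht
    have hℓ' : ℓ ≤ k := Nat.le_of_succ_le hℓ
    -- the level-`(ℓ+1)` isotypic component carries the scalar `c^{|T (ℓ+1)|}`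
    have hvℓ : v ∈ hwSubrep (ρ.comp (glLift hℓ)) (T ⟨ℓ + 1, Nat.lt_succ_of_le hℓ⟩) :=
      (mem_gtSubspace_iff ρ T v).1 hv ⟨ℓ + 1, Nat.lt_succ_of_le hℓ⟩
    have hscal := scalarGL_smul_of_mem_hwSubrep (ρ.comp (glLift hℓ)) _ c hvℓ
    rw [MonoidHom.comp_apply] at hscal
    have hρt : ρ (glLift hℓ t) v = ((c : K) ^ (T ⟨ℓ + 1, Nat.lt_succ_of_le hℓ⟩).size *
        ∏ i : Fin ℓ, (t' : Matrix (Fin ℓ) (Fin ℓ) K) i i ^ gtWeight T (Fin.castLE hℓ' i)) • v := by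
      rw [htfac, map_mul, map_mul, Module.End.mul_apply, glLift_glLift (Nat.le_succ ℓ) hℓ,
        ih hℓ' t' ht', map_smul, hscal, smul_smul, mul_comm]
    rw [hρt]
    congr 1
    -- bookkeeping of the scalar: `c^{|T_{ℓ+1}|} ∏_{i<ℓ} (t_i/c)^{w_i} = ∏_{i<ℓ+1} t_i^{w_i}`
    rw [Fin.prod_univ_castSucc]
    have hlast : (t : Matrix (Fin (ℓ + 1)) (Fin (ℓ + 1)) K) (Fin.last ℓ) (Fin.last ℓ) ^
        gtWeight T (Fin.castLE hℓ (Fin.last ℓ)) =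
        (c : K) ^ (T ⟨ℓ + 1, Nat.lt_succ_of_le hℓ⟩).size *
          ((c : K) ^ (T ⟨ℓ, Nat.lt_succ_of_le hℓ'⟩).size)⁻¹ := by
      rw [← hc, gtWeight]
      have h1 : (Fin.castLE hℓ (Fin.last ℓ)).succ = ⟨ℓ + 1, Nat.lt_succ_of_le hℓ⟩ := Fin.ext (by simp)
      have h2 : Fin.castSucc (Fin.castLE hℓ (Fin.last ℓ)) = ⟨ℓ, Nat.lt_succ_of_le hℓ'⟩ :=
        Fin.ext (by simp)
      rw [h1, h2, zpow_sub₀ c.ne_zero, div_eq_mul_inv]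
    rw [hlast]
    have hprod : ∏ i : Fin ℓ, (t : Matrix (Fin (ℓ + 1)) (Fin (ℓ + 1)) K) (Fin.castSucc i) (Fin.castSucc i) ^
        gtWeight T (Fin.castLE hℓ (Fin.castSucc i)) =
        (∏ i : Fin ℓ, (t' : Matrix (Fin ℓ) (Fin ℓ) K) i i ^ gtWeight T (Fin.castLE hℓ' i)) *
          (c : K) ^ (T ⟨ℓ, Nat.lt_succ_of_le hℓ'⟩).size := by
      rw [← sum_gtWeight_eq T ℓ hℓ', ← prod_zpow_eq_zpow_sum _ _ c.ne_zero, ← Finset.prod_mul_distrib]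
      refine Finset.prod_congr rfl fun i _ => ?_
      rw [← ht'c i, mul_zpow]
      rfl
    rw [hprod]
    have hcℓ : ((c : K) ^ (T ⟨ℓ, Nat.lt_succ_of_le hℓ'⟩).size) ≠ 0 := zpow_ne_zero _ c.ne_zero
    field_simp

/-- **`V_T ⊆ V_χ` with `χ = (|λ^{(1)}|, |λ^{(2)}| − |λ^{(1)}|, …, |λ^{(k)}| − |λ^{(k-1)}|)`**: the
Gelfand–Tsetlin component of a chain `T` lies in the weight space of weight `gtWeight T` — the
`T`-isotypic decomposition refines the weight decomposition ([BDGIL24, §4.5]: "`V_T` … is spanned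
by a weight vector of weight `(|λ^{(1)}|, |λ^{(2)}| − |λ^{(1)}|, …, |λ^{(k)}| − |λ^{(k-1)}|)`";
the 1-dimensionality — multiplicity-free branching — is NOT typed).
[cite: BergEtAl2024, §4.5, p.23 (PDF p.24)] locator: paper:arxiv-2411.03444 p0024.txt:L55–L56 -/
theorem gtSubspace_le_weightSpace (ρ : Representation K (GL (Fin k) K) V) (T : GTPattern k) :
    gtSubspace ρ T ≤ weightSpace ρ (gtWeight T) := by
  intro v hv t ht
  have h := glLift_diagonal_smul_of_mem_gtSubspace ρ T hv k le_rfl t ht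
  rw [glLift_refl] at h
  rw [h, weightChar]
  rfl

end Weights

section CoordRepWeights

variable {k d : ℕ}

/-- For metapolynomials: the `T`-isotypic component of the space of format-`(*, d, k)`
metapolynomials lies in the weight space of weight `gtWeight T` (so Thm. 1.1 (4) refines both
Thm. 1.1 (1) and (2)). [cite: BergEtAl2024, §4.5, p.23 (PDF p.24)] locator: paper:arxiv-2411.03444 p0024.txt:L55–L56 -/
theorem gtSubspace_coordRep_le_weightSpace (T : GTPattern k) :
    gtSubspace (coordRep (Fin k) ℂ d) T ≤ weightSpace (coordRep (Fin k) ℂ d) (gtWeight T) :=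
  gtSubspace_le_weightSpace _ T

end CoordRepWeights

end BergEtAl2024

end Literature.Barriers.ValiantsHypothesis
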